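import Summits.MatrixMultiplication.MatrixMultiplication.Theses.SnSubsetDichotomy
import Summits.MatrixMultiplication.MatrixMultiplication.Theorems.SnSubsetDichotomyHyperoctahedralSubsetsPairwisePacking

/-!
# `ThresholdSubsetTriples` (crux stmt-MatrixMultiplication-10882) — negative-side support IV:
# the rooted matching stabilisers `K_1, K_3, K_5` (pairwise trivial at polynomial slack `n³`)

For `n ≡ 2 (mod 4)` let `μ_a x = a - x` on `ℤ/n = Fin n` (`Equiv.subLeft a`, written `μ[n, a]`: the
perfect matching `{x, a-x}` for odd `a`) and `K_a = C(μ_a) ∩ Stab(0)` (written `K[n, a]`; local notations,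
no new definitions).  Sorry-free:

* `eq_one_of_commute_of_fix` (fixed-point propagation along the Hamiltonian cycle `M_a ∪ M_b`,
  `b - a ∈ {2,4}`): a permutation commuting with `μ_a, μ_b` and fixing `0` is trivial; hence
  `rootedStab_inf_eq_bot`, `rootedTriple_pairwise`.
* sizes: `(n·|K_a|)² ≥ n!` (`|C(μ_a)| = 2^m m!` by the tree theorem `natCard_centralizer_fpf_involution`,
  orbit–stabiliser as an inequality `card_le_card_mul_card_inf_stabilizer`, `binom(2m,m) ≤ 4^m`), whence
  `(n!)^{3/2} ≤ n³·|K_1||K_3||K_5|` (`factorial_rpow_le_rootedTriple`).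
The positive statement `SnThresholdCensus.PairwiseTrivialAtThreshold` (stmt-5541), which follows in three
lines, is a sibling route's item and is NOT asserted here (attached to that item as a candidate proof).
Used by `PairwiseVoid.lean` (the pairwise weakening of the crux holds) and `RootedTripleNotTPP.lean`.
-/

noncomputable section

set_option linter.dupNamespace false

open scoped BigOperators

namespace Summit.MatrixMultiplication.MatrixMultiplication.Theorems.ThresholdSubsetTriples.Negative

open Summit.MatrixMultiplication.MatrixMultiplication.Theses.SnSubsetDichotomy
open Summit.MatrixMultiplication.MatrixMultiplication.Theorems
open Literature.Combinatorics.Additive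
open Summit.MatrixMultiplication.MatrixMultiplication.Theorems.HyperoctahedralSubsets.PairwisePacking

section Pairwise

open Fin.CommRing

variable {n : ℕ} [NeZero n]

/-- `μ[n, a]`: the matching involution `x ↦ a - x` of `ℤ/n = Fin n` (perfect matching `{x, a - x}` for
`a` odd, `n` even); `K[n, a] = C(μ_a) ∩ Stab(0)`, the rooted matching stabiliser; `KT[n]`, the triple
`K_1, K_3, K_5` (local notations, no new definitions). -/
local notation3 (prettyPrint := false) "μ[" n ", " a "]" => (Equiv.subLeft ((a : ℕ) : Fin n) : Equiv.Perm (Fin n))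

local notation3 (prettyPrint := false) "K[" n ", " a "]" =>
  (Subgroup.centralizer {μ[n, a]} ⊓ MulAction.stabilizer (Equiv.Perm (Fin n)) (0 : Fin n) :
    Subgroup (Equiv.Perm (Fin n)))

local notation3 (prettyPrint := false) "KT[" n "]" => (![K[n, 1], K[n, 3], K[n, 5]] : Fin 3 → Subgroup (Equiv.Perm (Fin n)))

/-- `μ_a` is an involution. -/
theorem reflPerm_mul_self (a : ℕ) : μ[n, a] * μ[n, a] = 1 := by
  ext x
  simp [Equiv.Perm.mul_apply, sub_sub_cancel]

/-- For `n` even and `a` odd, `x ↦ a - x` has no fixed point. -/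
theorem reflPerm_ne_self (hn : 2 ∣ n) {a : ℕ} (ha : Odd a) (x : Fin n) : μ[n, a] x ≠ x := by
  intro h
  rw [Equiv.subLeft_apply, sub_eq_iff_eq_add] at h
  have hv := congrArg Fin.val h
  rw [Fin.val_natCast, Fin.val_add] at hv
  have h2 : (a % n) % 2 = ((x.val + x.val) % n) % 2 := by rw [hv]
  rw [Nat.mod_mod_of_dvd _ hn, Nat.mod_mod_of_dvd _ hn] at h2
  obtain ⟨r, hr⟩ := ha
  omega

/-- If `σ` commutes with `μ` and fixes `x`, it fixes `μ x`. -/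
theorem apply_eq_of_commute {α : Type*} {σ μ : Equiv.Perm α} (h : σ * μ = μ * σ) {x : α}
    (hx : σ x = x) : σ (μ x) = μ x := by
  have := congrArg (fun τ : Equiv.Perm α => τ x) h
  simp only [Equiv.Perm.mul_apply] at this
  rw [this, hx]

/-- Covering lemma: for `n ≡ 2 (mod 4)`, a property of `Fin n` holding at `0`, stable under `x ↦ x + 4`
and under one reflection `x ↦ a - x` with `a` odd, holds everywhere (`4ℤ + {0, 2} =` evens since
`4·(n+2)/4 ≡ 2`, and odd `= a -` even). -/
theorem forall_of_stable (hn : n % 4 = 2) (P : Fin n → Prop) (h0 : P 0)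
    (h4 : ∀ x, P x → P (x + 4)) {a : ℕ} (ha : Odd a) (hrefl : ∀ x, P x → P ((a : Fin n) - x)) :
    ∀ x, P x := by
  have hmul4 : ∀ j : ℕ, P ((4 * j : ℕ) : Fin n) := by
    intro j
    induction j with
    | zero => simpa using h0
    | succ j ih =>
      have h := h4 _ ih
      convert h using 1
      push_cast
      ring
  have h2 : P (2 : Fin n) := by
    have h := hmul4 ((n + 2) / 4)
    have hdiv : 4 * ((n + 2) / 4) = n + 2 := by omega
    rw [hdiv] at h
    convert h using 1
    push_cast
    rw [Fin.natCast_self, zero_add]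
  have hmul4' : ∀ j : ℕ, P ((4 * j + 2 : ℕ) : Fin n) := by
    intro j
    induction j with
    | zero => simpa using h2
    | succ j ih =>
      have h := h4 _ ih
      convert h using 1
      push_cast
      ring
  have heven : ∀ e : ℕ, P ((2 * e : ℕ) : Fin n) := by
    intro e
    obtain ⟨j, rfl | rfl⟩ := Nat.even_or_odd' e
    · convert hmul4 j using 2
      ring
    · convert hmul4' j using 2
      ring
  intro x
  obtain ⟨k, hk | hk⟩ := Nat.even_or_odd' x.val
  · have hx : x = ((2 * k : ℕ) : Fin n) := by rw [← hk, Fin.cast_val_eq_self]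
    rw [hx]
    exact heven k
  · obtain ⟨r, hr⟩ := ha
    have hx : x = ((2 * k + 1 : ℕ) : Fin n) := by rw [← hk, Fin.cast_val_eq_self]
    have hkn : k ≤ r + n := by have := x.isLt; omega
    rw [← sub_sub_cancel (a : Fin n) x]
    apply hrefl
    have hax : (a : Fin n) - x = ((2 * (r + n - k) : ℕ) : Fin n) := by
      rw [hx, hr]
      push_cast [Nat.cast_sub hkn]
      rw [Fin.natCast_self]
      ring
    rw [hax]
    exact heven _

/-- **Fixed-point propagation (the dihedral lemma).** For `n ≡ 2 (mod 4)`, odd `a` and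
`b = a + 2` or `b = a + 4`: a permutation commuting with both reflections `x ↦ a - x`, `x ↦ b - x`
and fixing `0` is the identity (its fixed set is stable under `x ↦ x + 4` and `x ↦ a - x`). -/
theorem eq_one_of_commute_of_fix (hn : n % 4 = 2) {a b : ℕ} (ha : Odd a) (hb : b = a + 2 ∨ b = a + 4)
    {σ : Equiv.Perm (Fin n)} (hca : σ * μ[n, a] = μ[n, a] * σ)
    (hcb : σ * μ[n, b] = μ[n, b] * σ) (h0 : σ 0 = 0) : σ = 1 := by
  have hall : ∀ x, σ x = x := by
    refine forall_of_stable hn (fun x => σ x = x) h0 ?_ ha ?_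
    · intro x hx
      rcases hb with rfl | rfl
      · have h1 := apply_eq_of_commute hcb (apply_eq_of_commute hca
          (apply_eq_of_commute hcb (apply_eq_of_commute hca hx)))
        simp only [Equiv.subLeft_apply] at h1
        convert h1 using 2 <;> push_cast <;> ring
      · have h1 := apply_eq_of_commute hcb (apply_eq_of_commute hca hx)
        simp only [Equiv.subLeft_apply] at h1
        convert h1 using 2 <;> push_cast <;> ring
    · intro x hx
      simpa only [Equiv.subLeft_apply] using apply_eq_of_commute hca hx
  ext x
  simp [hall x]

/-- Membership in `K_a`: commute with `μ_a` and fix `0`. -/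
theorem mem_rootedStab {a : ℕ} {σ : Equiv.Perm (Fin n)} :
    σ ∈ K[n, a] ↔ σ * μ[n, a] = μ[n, a] * σ ∧ σ 0 = 0 := by
  rw [Subgroup.mem_inf, Subgroup.mem_centralizer_singleton_iff, MulAction.mem_stabilizer_iff,
    Equiv.Perm.smul_def]

/-- Two rooted stabilisers of matchings at odd offsets `a`, `a + 2` / `a + 4` meet trivially. -/
theorem rootedStab_inf_eq_bot (hn : n % 4 = 2) {a b : ℕ} (ha : Odd a) (hb : b = a + 2 ∨ b = a + 4) :
    K[n, a] ⊓ K[n, b] = ⊥ := by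
  refine (Subgroup.eq_bot_iff_forall _).2 fun σ hσ => ?_
  obtain ⟨hσa, hσb⟩ := Subgroup.mem_inf.1 hσ
  rw [mem_rootedStab] at hσa hσb
  exact eq_one_of_commute_of_fix hn ha hb hσa.1 hσb.1 hσa.2

/-- Orbit–stabiliser as an inequality, relative to a subgroup: for `C ≤ G` acting on a finite `X`,
`|C| ≤ |X| · |C ⊓ Stab_G(x)|`. -/
theorem card_le_card_mul_card_inf_stabilizer {G X : Type*} [Group G] [MulAction G X] [Finite G]
    [Finite X] (C : Subgroup G) (x : X) :
    Nat.card C ≤ Nat.card X * Nat.card ↥(C ⊓ MulAction.stabilizer G x) := by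
  set S : Subgroup C := MulAction.stabilizer C x with hS
  have hidx : S.index = Nat.card (MulAction.orbit C x) := MulAction.index_stabilizer C x
  have horb : Nat.card (MulAction.orbit C x) ≤ Nat.card X := Finite.card_subtype_le _
  have hmul : Nat.card S * S.index = Nat.card C := Subgroup.card_mul_index S
  have hSeq : S = (C ⊓ MulAction.stabilizer G x).subgroupOf C := by
    ext g
    simp [hS, MulAction.mem_stabilizer_iff, Subgroup.mem_subgroupOf, Subgroup.smul_def]
  have hcardS : Nat.card S = Nat.card ↥(C ⊓ MulAction.stabilizer G x) := by
    rw [hSeq]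
    exact Nat.card_congr (Subgroup.subgroupOfEquivOfLe inf_le_left).toEquiv
  calc Nat.card C = Nat.card S * S.index := hmul.symm
    _ ≤ Nat.card S * Nat.card X := by rw [hidx]; exact Nat.mul_le_mul_left _ horb
    _ = Nat.card X * Nat.card ↥(C ⊓ MulAction.stabilizer G x) := by rw [hcardS, mul_comm]

/-- `(2m)! ≤ (2^m·m!)²` (central binomial coefficient `≤ 4^m`). -/
theorem factorial_two_mul_le_sq (m : ℕ) : (2 * m).factorial ≤ (2 ^ m * m.factorial) ^ 2 := by
  have hcb : Nat.centralBinom m * (m.factorial * m.factorial) = (2 * m).factorial := by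
    have h := Nat.choose_mul_factorial_mul_factorial (n := 2 * m) (k := m) (by omega)
    rw [show 2 * m - m = m by omega] at h
    rw [Nat.centralBinom_eq_two_mul_choose, ← h, mul_assoc]
  have h22 : (2 : ℕ) ^ m * 2 ^ m = 4 ^ m := by rw [← mul_pow]; norm_num
  calc (2 * m).factorial = Nat.centralBinom m * (m.factorial * m.factorial) := hcb.symm
    _ ≤ 4 ^ m * (m.factorial * m.factorial) :=
        Nat.mul_le_mul_right _ (Nat.centralBinom_le_four_pow m)
    _ = (2 ^ m * m.factorial) ^ 2 := by rw [← h22]; ring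

/-- **Size of a rooted stabiliser**: for `n` even and `a` odd, `(n · |K_a|)² ≥ n!`
(`|C(μ_a)| = 2^m m!` with `n = 2m`, orbit–stabiliser `n·|K_a| ≥ |C(μ_a)|`, and `(2^m m!)² ≥ (2m)!`). -/
theorem factorial_le_sq_mul_card_rootedStab (hn : 2 ∣ n) {a : ℕ} (ha : Odd a) :
    n.factorial ≤ (n * Nat.card (K[n, a])) ^ 2 := by
  have hn0 : 0 < n := Nat.pos_of_ne_zero (NeZero.ne n)
  obtain ⟨m, hnm, hcard⟩ := natCard_centralizer_fpf_involution hn0 (reflPerm_mul_self a)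
    (reflPerm_ne_self hn ha)
  have hle : Nat.card ↥(Subgroup.centralizer ({μ[n, a]} : Set (Equiv.Perm (Fin n)))) ≤
      n * Nat.card (K[n, a]) := by
    have h := card_le_card_mul_card_inf_stabilizer
      (Subgroup.centralizer ({μ[n, a]} : Set (Equiv.Perm (Fin n)))) (0 : Fin n)
    simpa only [Nat.card_eq_fintype_card (α := Fin n), Fintype.card_fin] using h
  rw [hcard] at hle
  calc n.factorial = (2 * m).factorial := by rw [hnm]
    _ ≤ (2 ^ m * m.factorial) ^ 2 := factorial_two_mul_le_sq m
    _ ≤ (n * Nat.card (K[n, a])) ^ 2 := Nat.pow_le_pow_left hle 2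

/-- The three rooted stabilisers `K_1, K_3, K_5` meet pairwise trivially (`n ≡ 2 mod 4`). -/
theorem rootedTriple_pairwise (hn : n % 4 = 2) :
    ∀ i j : Fin 3, i ≠ j → KT[n] i ⊓ KT[n] j = ⊥ := by
  have h13 : K[n, 1] ⊓ K[n, 3] = ⊥ :=
    rootedStab_inf_eq_bot hn ⟨0, rfl⟩ (Or.inl rfl)
  have h35 : K[n, 3] ⊓ K[n, 5] = ⊥ :=
    rootedStab_inf_eq_bot hn ⟨1, rfl⟩ (Or.inl rfl)
  have h15 : K[n, 1] ⊓ K[n, 5] = ⊥ :=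
    rootedStab_inf_eq_bot hn ⟨0, rfl⟩ (Or.inr rfl)
  intro i j hij
  fin_cases i <;> fin_cases j <;>
    simp only [Matrix.cons_val_zero, Matrix.cons_val_one, Matrix.head_cons,
      Matrix.cons_val_two, Matrix.tail_cons, Fin.isValue, Fin.mk_one, Fin.zero_eta,
      Fin.reduceFinMk] at hij ⊢
  all_goals first
    | exact absurd rfl hij
    | exact h13 | exact h35 | exact h15
    | (rw [inf_comm]; first | exact h13 | exact h35 | exact h15)

/-- **The volume inequality**: for `n ≡ 2 (mod 4)`,
`(n!)^{3/2} ≤ n³ · |K_1||K_3||K_5|`. -/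
theorem factorial_rpow_le_rootedTriple (hn : n % 4 = 2) :
    (n.factorial : ℝ) ^ ((3 : ℝ) / 2) ≤ (n : ℝ) ^ (3 : ℝ) *
      ((Nat.card (KT[n] 0) * Nat.card (KT[n] 1) * Nat.card (KT[n] 2) : ℕ) : ℝ) := by
  have h2 : 2 ∣ n := by omega
  have e1 := factorial_le_sq_mul_card_rootedStab (n := n) h2 (a := 1) ⟨0, rfl⟩
  have e3 := factorial_le_sq_mul_card_rootedStab (n := n) h2 (a := 3) ⟨1, rfl⟩
  have e5 := factorial_le_sq_mul_card_rootedStab (n := n) h2 (a := 5) ⟨2, rfl⟩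
  -- in ℕ: (n!)³ ≤ (n³ V)²
  set V : ℕ := Nat.card (KT[n] 0) * Nat.card (KT[n] 1) * Nat.card (KT[n] 2)
    with hV
  have hV' : V = Nat.card (K[n, 1]) * Nat.card (K[n, 3]) * Nat.card (K[n, 5]) := by
    simp [hV]
  have hnat : n.factorial ^ 3 ≤ (n ^ 3 * V) ^ 2 := by
    calc n.factorial ^ 3 = n.factorial * n.factorial * n.factorial := by ring
      _ ≤ (n * Nat.card (K[n, 1])) ^ 2 * (n * Nat.card (K[n, 3])) ^ 2 *
            (n * Nat.card (K[n, 5])) ^ 2 := Nat.mul_le_mul (Nat.mul_le_mul e1 e3) e5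
      _ = (n ^ 3 * V) ^ 2 := by rw [hV']; ring
  have hreal : ((n.factorial : ℝ)) ^ 3 ≤ (((n ^ 3 * V : ℕ) : ℝ)) ^ 2 := by exact_mod_cast hnat
  have hF : (0 : ℝ) ≤ (n.factorial : ℝ) := Nat.cast_nonneg _
  calc (n.factorial : ℝ) ^ ((3 : ℝ) / 2) = Real.sqrt ((n.factorial : ℝ) ^ 3) := by
        rw [Real.sqrt_eq_rpow, ← Real.rpow_natCast, ← Real.rpow_mul hF]
        norm_num
    _ ≤ Real.sqrt ((((n ^ 3 * V : ℕ) : ℝ)) ^ 2) := Real.sqrt_le_sqrt hreal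
    _ = ((n ^ 3 * V : ℕ) : ℝ) := Real.sqrt_sq (Nat.cast_nonneg _)
    _ = (n : ℝ) ^ (3 : ℝ) * (V : ℝ) := by
        rw [show (3 : ℝ) = ((3 : ℕ) : ℝ) by norm_num, Real.rpow_natCast]
        push_cast
        ring

end Pairwise


end Summit.MatrixMultiplication.MatrixMultiplication.Theorems.ThresholdSubsetTriples.Negative

end
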